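import Summits.QuantumFields.BalabanUV.Beta.SymRootedT2JetDictionary
import Summits.QuantumFields.BalabanUV.Beta.SymRootedGaugeCovariance
import Summits.QuantumFields.BalabanUV.Beta.BorderJetWard

/-!
# `BalabanUV.Beta.SymBorderJetWard` — THE GAUGE WARD IDENTITY OF THE (0.4)-SYMMETRISED ROOTED BORDER JET `symT2At` (product chart, gauge element
# `1 + τ_i λD` in the background slot `τ_i`) (β sub-cell, row D1, TABLES-SYM-LEAN S2c∕S2d, INTERFACE-LEVEL twin of an2-g21's `BorderJetWard`; an1 gen 43; the border path to (T2-B))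

HONEST FRAMING (cell charter, verbatim): «discharging BetaPertH makes Bałaban's UV stability UNCONDITIONAL — a real
constructive-QFT result; it is NOT the continuum limit and NOT the Clay problem.»  HONEST DEPENDENCY (verbatim): «continuum YM on
T⁴ ⇐ BetaPertH ∧ nine spine estimates (0/9 proved); BetaPertH ⇐ (D1) ∧ (D4) ∧ CAP+tail; G-an2-4 gates asym, D1 and NE2/3/4.»
ABSOLUTE RULE (R-g25-7 ∕ R-D1-g30-1 (A)): the (0.4)-symmetrised averaging is the exp of the MEAN OF LOGS over the pair family
`{loop^{σ,σ′}}` with weight `((d!)²·L^d)⁻¹`; every object below is the comb module's algebra read on an1's `symPhiGAt` (S2b part 1)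
instead of `PhiGAt` — STATEMENT FOR STATEMENT under the dictionary `PhiXAt ↦ symPhiXAt`, `XjetAt ↦ symXjetAt`, `MσXAt ↦ symMσXAt`,
`L^{-d}·linAvgAt ↦ (d!·L^d)⁻¹·symLinU`, `L^{-d}·hessUAt ↦ ((d!)²L^d)⁻¹·symHessUAt`, `L^{-2d}·vhUAt ↦ ((d!)²L^{2d})⁻¹·symVhUAt`
(an3-g63 [AN3-G63-S2C] (C-ii): constants PER BCH ORDER; CONVENTION `(d!)²` un-normalised inside order-2 sym functionals).
FAMILY-INDEPENDENT chart ∕ letter ∕ `Tau`-algebra lemmas of the comb module are imported BY NAME, never re-proved.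
DERIVED cell leaf: [folklore] ring algebra; the `sym*` families are [our object]s.  No statement of Bałaban's papers is typed here, no
`[cite:]` tag, no `Prop` is minted, no binder of the β-function wall (`hW`/`hR`/`D1Tel`/`D1Rep`, (D1), `BetaPertH`) is instantiated or
discharged; nothing about the VALUES of `symMixFFAt`∕`symVh₂SAt` and no (T2-B)∕(T2-M₂) letter is discharged in this file.
NOT D1, NOT BetaPertH, NOT continuum, NOT Clay.  NOT summit progress.
Provenance: β sub-cell, TABLES-SYM-LEAN S2c option (C) (S2C-SCOPE-v1 94facb80ac685517), unit b2b-balaban-beta-an1-g43 (W-supplier AN1,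
FREEZE (0): scratch for a courier; an1 files nothing), 2026-08-21; no existing file touched.

## What this module proves (sym twin of `BorderJetWard` §1 `PhiLAt_gauge`, §2, §3 `c11_QjetAt_upF_zero_B/B'`, §4; the slot gauge element `υ ῡ uR ubR`,
## the conjugated data `adυ gE gEb βfar`, the chart lemmas, `invT_conj_gauge`, `logT_quot_gauge` and the §3 letter expansions are the comb module's BY NAME)
(`r = L·y + ρ`; `a = λ(r)•D`; `ℓ²_! = (d!)²·L^{2d}`; `dA_κ(x) = (λ(x+e_κ) − λ(x))•D`; `β₁(X) = [λ(x)•D, X]`, `βfar(X) = [λ(x+e_κ)•D, X]`.)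
* §1 `symPhiLAt_gauge`: `symΦ^L_ρ(Ad_υω; gE, gĒ) = u(r)·symΦ^L_ρ(ω; E, Ē)·ū(r + L e_μ)` (an1's G1σ `SymRootedGaugeCovariance.symPhiGAt_gauge`).
* §2 **MASTER** `symQjetLAt_gauge`: for augmentation-one backgrounds, `symQjetLAt ρ (adυ ω) (gE E) (gEb Ē) = υ(r) · symQjetLAt ρ ω E Ē · ῡ(r)` — EXACT.
* §3 `c11_symQjetAt_upF_zero_B` ∕ `_B'` (no `τ₁`- resp. `τ₂`-letter: via an1's `symQjetAt_upF_neg_B/B'`, char ≠ 2).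
* §4 **THE SYMMETRISED BORDER JET WARD IDENTITIES** (`(d!:𝕜) ≠ 0`, `(L:𝕜) ≠ 0`, char ≠ 2; scalar fluctuation `upF W`): `c11_symQjetAt_gauge₁`:
  `c11 symQ^ρ(upF W; dA, X) = (2ℓ²_!)⁻¹•symVhUAt ρ W (βfar X) + (2ℓ²_!)⁻¹•symVhUAt ρ (β₁ W) X − [a, (2ℓ²_!)⁻¹•symVhUAt ρ W X]`, `c11_symQjetAt_gauge₂`:
  `c11 symQ^ρ(upF W; X, dA) = (2ℓ²_!)⁻¹•symVhUAt ρ W (β₁ X) + (2ℓ²_!)⁻¹•symVhUAt ρ (β₁ W) X − [a, (2ℓ²_!)⁻¹•symVhUAt ρ W X]`, and **`symT2At_gauge`** = their sum: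
  every term a FIRST-ORDER (`symVhUAt`) functional — the jet form, on the pair family, of the site law (W2-B).
-/

namespace Summit.QuantumFields.BalabanUV.Beta.SymBorderJetWard

open Finset
open Literature.MathematicalPhysics.QuantumFieldTheory.Balaban1983to89
open Literature.MathematicalPhysics.QuantumFieldTheory.Balaban1983to89.Beta
open scoped Nat
open AffineAveraging (Form1 unitVec)
open Summit.QuantumFields.BalabanUV.Beta.SymAveragingHessianCounts (symVhUAt)
open AveragingThirdJet (Tau Rho dmk fst_dmk snd_dmk dfst_mul dsnd_mul upF upF_apply Ebg Ebi logT invT augR augR_apply gaugeF gaugeB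
  logT_conj)
open AveragingThirdJet.Tau (τ₁ τ₂ τ12 ι c00 c10 c01 c11 mk ext4 τ₁_comm τ₂_comm)
open Summit.QuantumFields.BalabanUV.Beta.SymAveragingMixedJetTables (symPhiGAt symQjetAt symT2At)
open Summit.QuantumFields.BalabanUV.Beta.TruncatedNil4Calculus (nil4_augR eq_invT_of_mul_eq_one mul_invT_eq_one)
open Summit.QuantumFields.BalabanUV.Beta.SymRootedJetDictionary (aug_symPhiGAt_eq_one)
open Summit.QuantumFields.BalabanUV.Beta.SymRootedGaugeCovariance (symPhiGAt_gauge)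
open Summit.QuantumFields.BalabanUV.Beta.RootedJetReflection (GfL GbL fst_GfL snd_GfL fst_GbL snd_GbL augR_GfL augR_GbL)
open Summit.QuantumFields.BalabanUV.Beta.SymRootedJetReflection (symPhiLAt symQjetLAt symQjetAt_eq_symQjetLAt)
open Summit.QuantumFields.BalabanUV.Beta.SymRootedJetLinear (symQjetLAt_add symQjetLAt_τ₁_mul symQjetLAt_τ₂_mul)
open Summit.QuantumFields.BalabanUV.Beta.RootedJetTwist (flip1 c11_flip1)
open Summit.QuantumFields.BalabanUV.Beta.SymRootedJetTwist (c11_symQjetLAt_twist_of_aug c01_symQjetLAt_twist c10_symQjetLAt_twist)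
open Summit.QuantumFields.BalabanUV.Beta.RootedT2JetDictionary (flip2 c11_flip2)
open Summit.QuantumFields.BalabanUV.Beta.SymRootedT2JetDictionary (c10_symQjetAt_upF c01_symQjetAt_upF symQjetAt_upF_neg_B symQjetAt_upF_neg_B')
open Summit.QuantumFields.BalabanUV.Beta.MixedJetWard (βg1)
open Summit.QuantumFields.BalabanUV.Beta.BorderJetWard (υ ῡ uR ubR adυ gE gEb βfar υ_mul_ῡ ῡ_mul_υ uR_mul_ubR ubR_mul_uR gaugeF_GfL gaugeB_GbL adυ_zero
  augR_uR augR_ubR invT_conj_gauge logT_quot_gauge c11_conj₁ c11_conj₂ adυ_upF conj₁_Ebg conj₁_Ebi conj₂_Ebg conj₂_Ebi gE₁_Ebg gEb₁_Ebi gE₂_Ebg gEb₂_Ebi)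

variable {𝕜 : Type*} [Field 𝕜] {d : ℕ} {𝔸 : Type*} [Ring 𝔸] [Algebra 𝕜 𝔸]
variable (t : Tau 𝔸) (lam : (Fin d → ℤ) → 𝕜) (D : 𝔸)

/-! ## §1 The slot gauge element, its lift, the conjugated chart data, the chart lemmas, `invT_conj_gauge`, `logT_quot_gauge`: the comb module's
BY NAME; here only the chart averaging under the slot gauge, on the pair family -/

section Slot

variable {t}
variable (ht2 : t * t = 0) (htc : ∀ q : Tau 𝔸, t * q = q * t)
include ht2 htc

/-- [folklore] **THE CHART AVERAGING UNDER THE SLOT GAUGE** (an1's G1σ `symPhiGAt_gauge`): `Φ^L_ρ(Ad_υω; gE, gĒ) = u(r)·Φ^L_ρ(ω; E, Ē)·ū(r + L e_μ)`. -/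
theorem symPhiLAt_gauge (ρ : Fin d → ℤ) (ω E Eb : Form1 d (Tau 𝔸)) (L : ℕ) (μ : Fin d) (y : Fin d → ℤ) :
    symPhiLAt 𝕜 ρ (adυ t lam D ω) (gE t lam D E) (gEb t lam D Eb) L μ y
      = uR t lam D ((L : ℤ) • y + ρ) * symPhiLAt 𝕜 ρ ω E Eb L μ y * ubR t lam D ((L : ℤ) • y + ρ + (L : ℤ) • unitVec μ) := by
  rw [symPhiLAt, symPhiLAt, ← gaugeF_GfL lam D ht2 htc, ← gaugeB_GbL lam D ht2 htc]
  exact symPhiGAt_gauge (uR_mul_ubR lam D ht2 htc) (ubR_mul_uR lam D ht2 htc) ρ L μ y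

variable (ht0 : c00 t = 0)
include ht0

/-! ## §2 MASTER: the rooted jet of the gauge-transformed chart is the root conjugate of the rooted jet -/

/-- [folklore] **MASTER IDENTITY** (augmentation-one backgrounds): `symQjetLAt ρ (Ad_υω) (gE E) (gĒ Ē) = υ(r)·symQjetLAt ρ ω E Ē·ῡ(r)`, `r = L·y + ρ`. -/
theorem symQjetLAt_gauge {E Eb : Form1 d (Tau 𝔸)} (hE : ∀ κ x, c00 (E κ x) = 1) (hEb : ∀ κ x, c00 (Eb κ x) = 1) (ρ : Fin d → ℤ) (ω : Form1 d (Tau 𝔸)) (L : ℕ)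
    (μ : Fin d) (y : Fin d → ℤ) :
    symQjetLAt 𝕜 ρ (adυ t lam D ω) (gE t lam D E) (gEb t lam D Eb) L μ y
      = υ t lam D ((L : ℤ) • y + ρ) * symQjetLAt 𝕜 ρ ω E Eb L μ y * ῡ t lam D ((L : ℤ) • y + ρ) := by
  have h0 : augR 𝕜 (symPhiLAt 𝕜 ρ 0 E Eb L μ y) = 1 :=
    aug_symPhiGAt_eq_one (fun κ x => by rw [augR_GfL, hE]) (fun κ x => by rw [augR_GbL, hEb]) ρ L μ y
  unfold symQjetLAt
  rw [show symPhiLAt 𝕜 ρ 0 (gE t lam D E) (gEb t lam D Eb) L μ y = symPhiLAt 𝕜 ρ (adυ t lam D 0) (gE t lam D E) (gEb t lam D Eb) L μ y by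
      rw [adυ_zero], symPhiLAt_gauge lam D ht2 htc, symPhiLAt_gauge lam D ht2 htc, logT_quot_gauge lam D ht2 htc ht0 h0]
  simp only [uR, ubR, dsnd_mul, dfst_mul, fst_dmk, snd_dmk, mul_zero, zero_add, zero_mul, add_zero]

end Slot

/-! ## §3 The expansions at node 12's letters are the comb module's BY NAME; here only the component extraction -/

section Letters

/-- [folklore] `c11 symQ^ρ(upF W; 0, X) = 0` (no `τ₁`-letter anywhere; via 33J's sign flip, char ≠ 2). -/
theorem c11_symQjetAt_upF_zero_B (h2 : (2 : 𝕜) ≠ 0) (ρ : Fin d → ℤ) (W X : Form1 d 𝔸) (L : ℕ) (μ : Fin d) (y : Fin d → ℤ) :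
    c11 (symQjetAt 𝕜 ρ (upF W) 0 X L μ y) = 0 := by
  have h := congrArg c11 (symQjetAt_upF_neg_B (𝕜 := 𝕜) ρ W 0 X L μ y)
  rw [neg_zero, c11_flip1] at h
  have h' : (2 : 𝕜) • c11 (symQjetAt 𝕜 ρ (upF W) 0 X L μ y) = 0 := by rw [two_smul]; nth_rewrite 1 [h]; exact neg_add_cancel _
  exact (smul_eq_zero.1 h').resolve_left h2

/-- [folklore] `c11 symQ^ρ(upF W; X, 0) = 0`. -/
theorem c11_symQjetAt_upF_zero_B' (h2 : (2 : 𝕜) ≠ 0) (ρ : Fin d → ℤ) (W X : Form1 d 𝔸) (L : ℕ) (μ : Fin d) (y : Fin d → ℤ) :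
    c11 (symQjetAt 𝕜 ρ (upF W) X 0 L μ y) = 0 := by
  have h := congrArg c11 (symQjetAt_upF_neg_B' (𝕜 := 𝕜) ρ W X 0 L μ y)
  rw [neg_zero, c11_flip2] at h
  have h' : (2 : 𝕜) • c11 (symQjetAt 𝕜 ρ (upF W) X 0 L μ y) = 0 := by rw [two_smul]; nth_rewrite 1 [h]; exact neg_add_cancel _
  exact (smul_eq_zero.1 h').resolve_left h2

end Letters

/-! ## §4 The border jet Ward identities -/

section Ward

variable (hd : ((d ! : ℕ) : 𝕜) ≠ 0) {L : ℕ} (hL : (L : 𝕜) ≠ 0) (h2 : (2 : 𝕜) ≠ 0)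
include hd hL h2

/-- [folklore] **THE BORDER JET WARD IDENTITY, SLOT `τ₁`**: for a scalar fluctuation `upF W`, the pure-gauge background `dA` in the `τ₁`-slot and
any spectator `X` in the `τ₂`-slot,
`c11 symQ^ρ(upF W; dA, X) = (2(d!)²L^{2d})⁻¹•symVhUAt ρ W (βfar X) + (2(d!)²L^{2d})⁻¹•symVhUAt ρ (β₁ W) X − [λ(r)•D, (2(d!)²L^{2d})⁻¹•symVhUAt ρ W X]`. -/
theorem c11_symQjetAt_gauge₁ (ρ : Fin d → ℤ) (W X : Form1 d 𝔸) (μ : Fin d) (y : Fin d → ℤ) :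
    c11 (symQjetAt 𝕜 ρ (upF W) (fun κ x => (lam (x + unitVec κ) - lam x) • D) X L μ y)
      = ((2 : 𝕜) * ((d ! : 𝕜) ^ 2 * (L : 𝕜) ^ (2 * d)))⁻¹ • symVhUAt ρ W (βfar lam D X) L μ y
        + ((2 : 𝕜) * ((d ! : 𝕜) ^ 2 * (L : 𝕜) ^ (2 * d)))⁻¹ • symVhUAt ρ (βg1 lam D W) X L μ y
        - ((lam ((L : ℤ) • y + ρ) • D) * (((2 : 𝕜) * ((d ! : 𝕜) ^ 2 * (L : 𝕜) ^ (2 * d)))⁻¹ • symVhUAt ρ W X L μ y)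
            - (((2 : 𝕜) * ((d ! : 𝕜) ^ 2 * (L : 𝕜) ^ (2 * d)))⁻¹ • symVhUAt ρ W X L μ y) * (lam ((L : ℤ) • y + ρ) • D)) := by
  -- MASTER at t = τ₁, E = Ebg dA X, Ē = Ebi dA X, ω = upF W
  have key := congrArg c11 (symQjetLAt_gauge (t := τ₁) lam D AveragingThirdJet.Tau.τ₁_mul_τ₁ τ₁_comm AveragingThirdJet.Tau.c00_τ₁
    (E := Ebg (fun κ x => (lam (x + unitVec κ) - lam x) • D) X) (Eb := Ebi (fun κ x => (lam (x + unitVec κ) - lam x) • D) X) (fun κ x => AveragingThirdJet.c00_Ebg _ _ κ x) (fun κ x => AveragingThirdJet.c00_Ebi _ _ κ x) ρ (upF W) L μ y)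
  rw [gE₁_Ebg, gEb₁_Ebi, adυ_upF τ₁ lam D AveragingThirdJet.Tau.τ₁_mul_τ₁ τ₁_comm, symQjetLAt_add, symQjetLAt_τ₁_mul,
    AveragingThirdJet.Tau.c11_add, AveragingThirdJet.Tau.c11_τ₁_mul,
    c11_symQjetLAt_twist_of_aug _ _ _ _ (fun κ x => AveragingThirdJet.c00_Ebg _ _ κ x) (fun κ x => AveragingThirdJet.c00_Ebi _ _ κ x),
    c01_symQjetLAt_twist, ← symQjetAt_eq_symQjetLAt, ← symQjetAt_eq_symQjetLAt, ← symQjetAt_eq_symQjetLAt] at key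
  simp only [sub_self] at key
  rw [c11_symQjetAt_upF_zero_B h2, zero_add, υ, ῡ, c11_conj₁] at key
  have eW : (fun κ x => ι (c00 (upF W κ x))) = upF W := by funext κ x; simp
  rw [eW, c10_symQjetAt_upF (hd := hd) (hL := hL) (h2 := h2), c01_symQjetAt_upF (hd := hd) (hL := hL) (h2 := h2), c01_symQjetAt_upF (hd := hd) (hL := hL) (h2 := h2)] at key
  -- key : (2(d!)²L^{2d})⁻¹•vh(W, βfar X) + (2(d!)²L^{2d})⁻¹•vh(β₁ W, X) = c11 Q(upF W; dA, X) + (a·c01 − c01·a)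
  rw [eq_sub_iff_add_eq]
  exact key.symm

/-- [folklore] **THE BORDER JET WARD IDENTITY, SLOT `τ₂`**: `c11 symQ^ρ(upF W; X, dA) = (2(d!)²L^{2d})⁻¹•symVhUAt ρ W (β₁ X) + (2(d!)²L^{2d})⁻¹•symVhUAt ρ (β₁ W) X
− [λ(r)•D, (2(d!)²L^{2d})⁻¹•symVhUAt ρ W X]`. -/
theorem c11_symQjetAt_gauge₂ (ρ : Fin d → ℤ) (W X : Form1 d 𝔸) (μ : Fin d) (y : Fin d → ℤ) :
    c11 (symQjetAt 𝕜 ρ (upF W) X (fun κ x => (lam (x + unitVec κ) - lam x) • D) L μ y)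
      = ((2 : 𝕜) * ((d ! : 𝕜) ^ 2 * (L : 𝕜) ^ (2 * d)))⁻¹ • symVhUAt ρ W (βg1 lam D X) L μ y
        + ((2 : 𝕜) * ((d ! : 𝕜) ^ 2 * (L : 𝕜) ^ (2 * d)))⁻¹ • symVhUAt ρ (βg1 lam D W) X L μ y
        - ((lam ((L : ℤ) • y + ρ) • D) * (((2 : 𝕜) * ((d ! : 𝕜) ^ 2 * (L : 𝕜) ^ (2 * d)))⁻¹ • symVhUAt ρ W X L μ y)
            - (((2 : 𝕜) * ((d ! : 𝕜) ^ 2 * (L : 𝕜) ^ (2 * d)))⁻¹ • symVhUAt ρ W X L μ y) * (lam ((L : ℤ) • y + ρ) • D)) := by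
  have key := congrArg c11 (symQjetLAt_gauge (t := τ₂) lam D AveragingThirdJet.Tau.τ₂_mul_τ₂ τ₂_comm AveragingThirdJet.Tau.c00_τ₂
    (E := Ebg X (fun κ x => (lam (x + unitVec κ) - lam x) • D)) (Eb := Ebi X (fun κ x => (lam (x + unitVec κ) - lam x) • D)) (fun κ x => AveragingThirdJet.c00_Ebg _ _ κ x) (fun κ x => AveragingThirdJet.c00_Ebi _ _ κ x) ρ (upF W) L μ y)
  rw [gE₂_Ebg, gEb₂_Ebi, adυ_upF τ₂ lam D AveragingThirdJet.Tau.τ₂_mul_τ₂ τ₂_comm, symQjetLAt_add, symQjetLAt_τ₂_mul,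
    AveragingThirdJet.Tau.c11_add, AveragingThirdJet.Tau.c11_τ₂_mul,
    c11_symQjetLAt_twist_of_aug _ _ _ _ (fun κ x => AveragingThirdJet.c00_Ebg _ _ κ x) (fun κ x => AveragingThirdJet.c00_Ebi _ _ κ x),
    c10_symQjetLAt_twist, ← symQjetAt_eq_symQjetLAt, ← symQjetAt_eq_symQjetLAt, ← symQjetAt_eq_symQjetLAt] at key
  simp only [sub_self] at key
  rw [c11_symQjetAt_upF_zero_B' h2, zero_add, υ, ῡ, c11_conj₂] at key
  have eW : (fun κ x => ι (c00 (upF W κ x))) = upF W := by funext κ x; simp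
  rw [eW, c10_symQjetAt_upF (hd := hd) (hL := hL) (h2 := h2), c10_symQjetAt_upF (hd := hd) (hL := hL) (h2 := h2), c10_symQjetAt_upF (hd := hd) (hL := hL) (h2 := h2)] at key
  rw [eq_sub_iff_add_eq]
  exact key.symm

/-- [folklore] **THE GAUGE WARD IDENTITY OF THE (0.4)-SYMMETRISED ROOTED BORDER JET `symT2At`** (the sum of the two slots):
`symT2At ρ (upF W) dA X = [slot τ₁] + [slot τ₂]` — every term a first-order (`symVhUAt`) functional. -/
theorem symT2At_gauge (ρ : Fin d → ℤ) (W X : Form1 d 𝔸) (μ : Fin d) (y : Fin d → ℤ) :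
    symT2At 𝕜 ρ (upF W) (fun κ x => (lam (x + unitVec κ) - lam x) • D) X L μ y
      = (((2 : 𝕜) * ((d ! : 𝕜) ^ 2 * (L : 𝕜) ^ (2 * d)))⁻¹ • symVhUAt ρ W (βfar lam D X) L μ y
          + ((2 : 𝕜) * ((d ! : 𝕜) ^ 2 * (L : 𝕜) ^ (2 * d)))⁻¹ • symVhUAt ρ (βg1 lam D W) X L μ y
          - ((lam ((L : ℤ) • y + ρ) • D) * (((2 : 𝕜) * ((d ! : 𝕜) ^ 2 * (L : 𝕜) ^ (2 * d)))⁻¹ • symVhUAt ρ W X L μ y)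
              - (((2 : 𝕜) * ((d ! : 𝕜) ^ 2 * (L : 𝕜) ^ (2 * d)))⁻¹ • symVhUAt ρ W X L μ y) * (lam ((L : ℤ) • y + ρ) • D)))
        + (((2 : 𝕜) * ((d ! : 𝕜) ^ 2 * (L : 𝕜) ^ (2 * d)))⁻¹ • symVhUAt ρ W (βg1 lam D X) L μ y
          + ((2 : 𝕜) * ((d ! : 𝕜) ^ 2 * (L : 𝕜) ^ (2 * d)))⁻¹ • symVhUAt ρ (βg1 lam D W) X L μ y
          - ((lam ((L : ℤ) • y + ρ) • D) * (((2 : 𝕜) * ((d ! : 𝕜) ^ 2 * (L : 𝕜) ^ (2 * d)))⁻¹ • symVhUAt ρ W X L μ y)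
              - (((2 : 𝕜) * ((d ! : 𝕜) ^ 2 * (L : 𝕜) ^ (2 * d)))⁻¹ • symVhUAt ρ W X L μ y) * (lam ((L : ℤ) • y + ρ) • D))) := by
  rw [symT2At, c11_symQjetAt_gauge₁ lam D hd hL h2, c11_symQjetAt_gauge₂ lam D hd hL h2]

end Ward

end Summit.QuantumFields.BalabanUV.Beta.SymBorderJetWard
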